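import Literature.Topology.FourManifolds.OpenTraceCollar
import Literature.Topology.FourManifolds.MMSWRasmussen

/-!
# Helper `helper_friendsCarrier_Tk_shrinkTube` of stub `helper_friendsCarrier_Tk`: the fibre-shrunken tube
(item stmt-SmoothPoincare4-16128, route route-SmoothPoincare4-DottedCircleRasmussen)

A bookkeeping piece of the relative open trace `T_k` (`helper_friendsCarrier_Tk`, line `mk_friends`):
as in the `k = 0` template (`TubeNbhd.shrink`, `OpenTraceCollar.lean`), the trace is to be built from the
FIBRE-SHRUNKEN tube `ν'(u, w'') = ν(u, univBall 0 2 w'')` (range `ν(𝕊¹ × B(0,2))`, so that the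
`ν`-coordinates extend across the frontier of the range of `ν'` and every cocore point has
`ν`-radius `< 2`, the scale of the corner-turning profile), while the `3`-manifold `Y` is presented with
`ν` itself.  This file checks that `ν'` again satisfies the tube hypotheses of the trace datum
(`FriendsTk.TraceDatum`, pieces (1)–(3)): it is `C^∞`, injective, an immersion (the differential of
`id × univBall 0 2` is injective because `id × (univBall 0 2)⁻¹` is a smooth left inverse), takes
values in `M_k`, and has the same zero section `K₀`; and records the fibre identities.

Everything is proved; no definitions, no named facts, no `sorry`.
References: the template `OpenTraceCollar.lean` (`TubeNbhd.shrink`); Hirsch, *Differential Topology*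
(1976), §4.5 [HirschDT1976].
-/

-- the prescribed namespace `Summit.<P>.<Sub>.…` duplicates `SmoothPoincare4` (P = Sub)
set_option linter.dupNamespace false
set_option linter.style.longLine false

noncomputable section

open scoped Manifold ContDiff Topology
open Function Set Metric
open Literature.Topology.FourManifolds Literature.Topology.FourManifolds.MMSW

namespace Summit.SmoothPoincare4.SmoothPoincare4.Theorems.DcrGap.MkFriends

namespace FriendsTk

/-- A continuous linear map with a left inverse is injective (pointwise form). [folklore] -/
theorem injective_of_leftInverse_clm {R₁ M₁ M₂ : Type*} [Semiring R₁] [TopologicalSpace M₁] [AddCommMonoid M₁]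
    [Module R₁ M₁] [TopologicalSpace M₂] [AddCommMonoid M₂] [Module R₁ M₂] {A : M₁ →L[R₁] M₂}
    {B : M₂ →L[R₁] M₁} (h : ∀ v, B (A v) = v) : Injective A := fun v w hvw => by
  rw [← h v, ← h w, hvw]

/-- **The fibre-shrunken tube is again a tube.**  For a `C^∞` injective immersion
`ν : 𝕊¹ × ℝ² → M_k` with zero section `K₀`, the map `ν'(u, w'') = ν(u, univBall 0 2 w'')` is a `C^∞`
injective immersion into `M_k` with zero section `K₀`, `‖univBall 0 2 w''‖ < 2`, and
`ν'(u, univBall⁻¹ w) = ν(u, w)` for `‖w‖ < 2`. [cite: HirschDT1976, §4.5] -/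
theorem shrinkTube_aux {k : ℕ} {K₀ : (Metric.sphere (0 : EuclideanSpace ℝ (Fin 2)) 1) → EuclideanSpace ℝ (Fin 4)}
    {νK : (Metric.sphere (0 : EuclideanSpace ℝ (Fin 2)) 1) × EuclideanSpace ℝ (Fin 2) → EuclideanSpace ℝ (Fin 4)}
    (hν : ContMDiff ((𝓡 1).prod 𝓘(ℝ, EuclideanSpace ℝ (Fin 2))) 𝓘(ℝ, EuclideanSpace ℝ (Fin 4)) ∞ νK)
    (hinj : Injective νK)
    (himm : ∀ p, Injective (mfderiv ((𝓡 1).prod 𝓘(ℝ, EuclideanSpace ℝ (Fin 2))) 𝓘(ℝ, EuclideanSpace ℝ (Fin 4)) νK p))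
    (hmem : ∀ p, νK p ∈ modelBoundary k) (hK : ∀ u, νK (u, 0) = K₀ u) :
    ContMDiff ((𝓡 1).prod 𝓘(ℝ, EuclideanSpace ℝ (Fin 2))) 𝓘(ℝ, EuclideanSpace ℝ (Fin 4)) ∞
        (fun q : (Metric.sphere (0 : EuclideanSpace ℝ (Fin 2)) 1) × EuclideanSpace ℝ (Fin 2) =>
          νK (q.1, OpenPartialHomeomorph.univBall (0 : EuclideanSpace ℝ (Fin 2)) 2 q.2)) ∧
      Injective (fun q : (Metric.sphere (0 : EuclideanSpace ℝ (Fin 2)) 1) × EuclideanSpace ℝ (Fin 2) =>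
          νK (q.1, OpenPartialHomeomorph.univBall (0 : EuclideanSpace ℝ (Fin 2)) 2 q.2)) ∧
      (∀ p, Injective (mfderiv ((𝓡 1).prod 𝓘(ℝ, EuclideanSpace ℝ (Fin 2))) 𝓘(ℝ, EuclideanSpace ℝ (Fin 4))
        (fun q : (Metric.sphere (0 : EuclideanSpace ℝ (Fin 2)) 1) × EuclideanSpace ℝ (Fin 2) =>
          νK (q.1, OpenPartialHomeomorph.univBall (0 : EuclideanSpace ℝ (Fin 2)) 2 q.2)) p)) ∧
      (∀ p, (fun q : (Metric.sphere (0 : EuclideanSpace ℝ (Fin 2)) 1) × EuclideanSpace ℝ (Fin 2) =>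
          νK (q.1, OpenPartialHomeomorph.univBall (0 : EuclideanSpace ℝ (Fin 2)) 2 q.2)) p ∈ modelBoundary k) ∧
      (∀ u, (fun q : (Metric.sphere (0 : EuclideanSpace ℝ (Fin 2)) 1) × EuclideanSpace ℝ (Fin 2) =>
          νK (q.1, OpenPartialHomeomorph.univBall (0 : EuclideanSpace ℝ (Fin 2)) 2 q.2)) (u, 0) = K₀ u) ∧
      (∀ q : (Metric.sphere (0 : EuclideanSpace ℝ (Fin 2)) 1) × EuclideanSpace ℝ (Fin 2),
        ‖(OpenPartialHomeomorph.univBall (0 : EuclideanSpace ℝ (Fin 2)) 2 q.2 : EuclideanSpace ℝ (Fin 2))‖ < 2) ∧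
      (∀ (u : Metric.sphere (0 : EuclideanSpace ℝ (Fin 2)) 1) (w : EuclideanSpace ℝ (Fin 2)), ‖w‖ < 2 →
        (fun q : (Metric.sphere (0 : EuclideanSpace ℝ (Fin 2)) 1) × EuclideanSpace ℝ (Fin 2) =>
          νK (q.1, OpenPartialHomeomorph.univBall (0 : EuclideanSpace ℝ (Fin 2)) 2 q.2))
            (u, (OpenPartialHomeomorph.univBall (0 : EuclideanSpace ℝ (Fin 2)) 2).symm w) = νK (u, w)) := by
  set B := OpenPartialHomeomorph.univBall (0 : EuclideanSpace ℝ (Fin 2)) 2 with hB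
  set F : (Metric.sphere (0 : EuclideanSpace ℝ (Fin 2)) 1) × EuclideanSpace ℝ (Fin 2) →
      (Metric.sphere (0 : EuclideanSpace ℝ (Fin 2)) 1) × EuclideanSpace ℝ (Fin 2) := fun q => (q.1, B q.2) with hF
  set G : (Metric.sphere (0 : EuclideanSpace ℝ (Fin 2)) 1) × EuclideanSpace ℝ (Fin 2) →
      (Metric.sphere (0 : EuclideanSpace ℝ (Fin 2)) 1) × EuclideanSpace ℝ (Fin 2) := fun q => (q.1, B.symm q.2) with hG
  have hn : (∞ : ℕ∞ω) ≠ 0 := by simp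
  have hGF : ∀ q, G (F q) = q := fun q => by
    simp only [hF, hG, hB, TubeNbhd.univBall_symm_apply_apply]
  have hFs : ContMDiff ((𝓡 1).prod 𝓘(ℝ, EuclideanSpace ℝ (Fin 2))) ((𝓡 1).prod 𝓘(ℝ, EuclideanSpace ℝ (Fin 2))) ∞ F :=
    contMDiff_fst.prodMk ((OpenPartialHomeomorph.contDiff_univBall (c := (0 : EuclideanSpace ℝ (Fin 2)))
      (r := 2)).contMDiff.comp contMDiff_snd)
  have hcomp : (fun q : (Metric.sphere (0 : EuclideanSpace ℝ (Fin 2)) 1) × EuclideanSpace ℝ (Fin 2) =>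
      νK (q.1, OpenPartialHomeomorph.univBall (0 : EuclideanSpace ℝ (Fin 2)) 2 q.2)) = νK ∘ F := rfl
  rw [hcomp]
  refine ⟨hν.comp hFs, hinj.comp (LeftInverse.injective hGF), fun p => ?_, fun p => hmem _, fun u => ?_,
    fun q => TubeNbhd.norm_univBall_lt q.2, fun u w hw => ?_⟩
  · -- immersion: `dν' = dν ∘ dF`, and `dG ∘ dF = id`
    have hFd : MDifferentiableAt ((𝓡 1).prod 𝓘(ℝ, EuclideanSpace ℝ (Fin 2))) ((𝓡 1).prod 𝓘(ℝ, EuclideanSpace ℝ (Fin 2)))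
        F p := hFs.mdifferentiableAt hn
    have hB2 : B p.2 ∈ Metric.ball (0 : EuclideanSpace ℝ (Fin 2)) 2 := by
      simpa using TubeNbhd.norm_univBall_lt p.2
    have hGd : MDifferentiableAt ((𝓡 1).prod 𝓘(ℝ, EuclideanSpace ℝ (Fin 2))) ((𝓡 1).prod 𝓘(ℝ, EuclideanSpace ℝ (Fin 2)))
        G (F p) := by
      have h1 : ContMDiffAt 𝓘(ℝ, EuclideanSpace ℝ (Fin 2)) 𝓘(ℝ, EuclideanSpace ℝ (Fin 2)) ∞ B.symm (B p.2) :=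
        ((OpenPartialHomeomorph.contDiffOn_univBall_symm (c := (0 : EuclideanSpace ℝ (Fin 2))) (r := 2)).contDiffAt
          (Metric.isOpen_ball.mem_nhds hB2)).contMDiffAt
      have h2 : ContMDiffAt ((𝓡 1).prod 𝓘(ℝ, EuclideanSpace ℝ (Fin 2))) ((𝓡 1).prod 𝓘(ℝ, EuclideanSpace ℝ (Fin 2))) ∞
          G (F p) :=
        contMDiffAt_fst.prodMk (h1.comp (F p) contMDiffAt_snd)
      exact h2.mdifferentiableAt hn
    have hνd : MDifferentiableAt ((𝓡 1).prod 𝓘(ℝ, EuclideanSpace ℝ (Fin 2))) 𝓘(ℝ, EuclideanSpace ℝ (Fin 4)) νK (F p) :=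
      hν.mdifferentiableAt hn
    rw [mfderiv_comp p hνd hFd]
    have hid : (mfderiv ((𝓡 1).prod 𝓘(ℝ, EuclideanSpace ℝ (Fin 2))) ((𝓡 1).prod 𝓘(ℝ, EuclideanSpace ℝ (Fin 2))) G (F p)).comp
        (mfderiv ((𝓡 1).prod 𝓘(ℝ, EuclideanSpace ℝ (Fin 2))) ((𝓡 1).prod 𝓘(ℝ, EuclideanSpace ℝ (Fin 2))) F p) =
        ContinuousLinearMap.id ℝ _ := by
      rw [← mfderiv_comp p hGd hFd, show G ∘ F = id from funext hGF, mfderiv_id]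
    have hFinj : Injective (mfderiv ((𝓡 1).prod 𝓘(ℝ, EuclideanSpace ℝ (Fin 2))) ((𝓡 1).prod 𝓘(ℝ, EuclideanSpace ℝ (Fin 2))) F p) :=
      injective_of_leftInverse_clm fun v => by
        have := DFunLike.congr_fun hid v
        exact this
    exact (himm (F p)).comp hFinj
  · show νK (u, B 0) = K₀ u
    rw [hB, OpenPartialHomeomorph.univBall_apply_zero]; exact hK u
  · show νK (u, B (B.symm w)) = νK (u, w)
    rw [hB, TubeNbhd.univBall_apply_symm_apply hw]

end FriendsTk

/-- **Helper `helper_friendsCarrier_Tk_shrinkTube`** (registered on the crux item; bookkeeping piece of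
the relative open trace `T_k` of stub `helper_friendsCarrier_Tk`): the fibre-shrunken tube
`ν'(u, w'') = ν(u, univBall 0 2 w'')` of a `C^∞` injective immersion `ν : 𝕊¹ × ℝ² → M_k` with zero
section `K₀` is again one (so pieces (1)–(3) apply to it), with `‖univBall 0 2 w''‖ < 2` and
`ν'(u, univBall⁻¹ w) = ν(u, w)` for `‖w‖ < 2` (the template's `TubeNbhd.shrink`). [cite: HirschDT1976, §4.5] -/
theorem helper_friendsCarrier_Tk_shrinkTube : ∀ (k : ℕ) (K₀ : (sphere (0 : EuclideanSpace ℝ (Fin 2)) 1) → EuclideanSpace ℝ (Fin 4)) (νK : (sphere (0 : EuclideanSpace ℝ (Fin 2)) 1) × EuclideanSpace ℝ (Fin 2) → EuclideanSpace ℝ (Fin 4)), ContMDiff ((𝓡 1).prod 𝓘(ℝ, EuclideanSpace ℝ (Fin 2))) 𝓘(ℝ, EuclideanSpace ℝ (Fin 4)) ((⊤ : ℕ∞) : WithTop ℕ∞) νK → Injective νK → (∀ p, Injective (mfderiv ((𝓡 1).prod 𝓘(ℝ, EuclideanSpace ℝ (Fin 2))) 𝓘(ℝ, EuclideanSpace ℝ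 (Fin 4)) νK p)) → (∀ p, νK p ∈ modelBoundary k) → (∀ u, νK (u, 0) = K₀ u) → ContMDiff ((𝓡 1).prod 𝓘(ℝ, EuclideanSpace ℝ (Fin 2))) 𝓘(ℝ, EuclideanSpace ℝ (Fin 4)) ((⊤ : ℕ∞) : WithTop ℕ∞) (fun q : (sphere (0 : EuclideanSpace ℝ (Fin 2)) 1) × EuclideanSpace ℝ (Fin 2) => νK (q.1, OpenPartialHomeomorph.univBall (0 : EuclideanSpace ℝ (Fin 2)) 2 q.2)) ∧ Injective (fun q : (sphere (0 : EuclideanSpace ℝ (Fin 2)) 1) × EuclideanSpace ℝ (Fin 2) => νK (q.1, OpenPartialHomeomorph.univBall (0 : EuclideanSpace ℝ (Fin 2)) 2 q.2)) ∧ (∀ p, Injective (mfderiv ((𝓡 1).prod 𝓘(ℝ, EuclideanSpace ℝ (Fin 2))) 𝓘(ℝ, EuclideanSpace ℝ (Fin 4)) (fun q : (sphere (0 : EuclideanSpace ℝ (Fin 2)) 1) × EuclideanSpace ℝ (Fin 2) => νK (q.1, OpenPartialHomeomorph.univBall (0 : EuclideanSpace ℝ (Fin 2)) 2 q.2)) p))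 ∧ (∀ p, (fun q : (sphere (0 : EuclideanSpace ℝ (Fin 2)) 1) × EuclideanSpace ℝ (Fin 2) => νK (q.1, OpenPartialHomeomorph.univBall (0 : EuclideanSpace ℝ (Fin 2)) 2 q.2)) p ∈ modelBoundary k) ∧ (∀ u, (fun q : (sphere (0 : EuclideanSpace ℝ (Fin 2)) 1) × EuclideanSpace ℝ (Fin 2) => νK (q.1, OpenPartialHomeomorph.univBall (0 : EuclideanSpace ℝ (Fin 2)) 2 q.2)) (u, 0) = K₀ u) ∧ (∀ q : (sphere (0 : EuclideanSpace ℝ (Fin 2)) 1) × EuclideanSpace ℝ (Fin 2), ‖(OpenPartialHomeomorph.univBall (0 : EuclideanSpace ℝ (Fin 2)) 2 q.2 : EuclideanSpace ℝ (Fin 2))‖ < 2) ∧ (∀ (u : (sphere (0 : EuclideanSpace ℝ (Fin 2)) 1)) (w : EuclideanSpace ℝ (Fin 2)), ‖w‖ < 2 → (fun q : (sphere (0 : EuclideanSpace ℝ (Fin 2)) 1) × EuclideanSpace ℝ (Fin 2) => νK (q.1, OpenPartialHomeomorph.univBall (0 : EuclideanSpace ℝ (Fin 2)) 2 q.2)) (u,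 (OpenPartialHomeomorph.univBall (0 : EuclideanSpace ℝ (Fin 2)) 2).symm w) = νK (u, w)) :=
  fun _ _ _ hν hinj himm hmem hK => FriendsTk.shrinkTube_aux hν hinj himm hmem hK

end Summit.SmoothPoincare4.SmoothPoincare4.Theorems.DcrGap.MkFriends

end
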